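import Literature.NumberTheory.Transcendental.RoySmallValueMain

/-!
# Route `RoyCriterion`, crux `RoySmallValueDirichletGap` (stmt-Schanuel-1050), line
# `two-sided-absorption-transfer` — helper for the stub `StubEnemyOrbits`: Steps 3–4

Roy 2013, §7, Steps 3 and 4, re-run from the tree's proof of Roy's Theorem 1.1
(`Literature.NumberTheory.Transcendental.Roy2013.roy2013_thm_1_1_holds`, Steps 3 and 4–5) with the
output EXPOSED: given the families of the proof (the integer forms `P̃_n`, all of whose derivatives
`𝒟ʲP̃_n`, `j ≤ 2T_n`, lie in the bodies `𝒞_n = royBody n ξ η (3n^β) (n^ν/4) T_n`, their level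
packages `L_n` with coordinates in one normal number field `K`, the level thresholds, and the
separation constant `ε₁` of the level `D₁ + 1`) and the output of Step 2 at the level `D` (an orbit
`O = orb j₀` of a package `L` of level `D` on which the integer forms of `𝒞_D` vanish, with the
chart `u₀u₂ ≠ 0` and a point `u_{j₁}`, `j₁ ∈ O`, at distance `< ε₁` from `(1:γ)`), the level
`D* = Ds` ("the smallest positive integer for which `Z ⊆ 𝒵(𝒟ⁱP̃_{D*+1} ; 0 ≤ i < 2⌊(D*+1)^τ⌋)`")
satisfies `1 ≤ D* < D`, the Step-3 bounds `#O ≤ 8 (D*)^{2−τ}`, `h(O) ≤ 74·2^{1+β−τ} (D*)^{1+β−τ}`,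
and the Step-4 inequality for EVERY `𝒮 ⊆ O ∩ 𝒰`:
`∑_{j∈𝒮} max{T* log dist(u_j,(1:γ)), log dist(u_j,A_γ)} ≥ −(8 (D*)^β #O + D* h(O))`, `T* = ⌊(D*)^τ⌋`
(`ZeroConfigK.step4_orbit` with the tree's Step-4 constant threshold). No lower bound on `ν` is
used. No definitions.

## References

* [Roy2013] D. Roy, *A small value estimate for 𝔾ₐ × 𝔾ₘ*, Mathematika 59 (2013), 333–363
  (arXiv:1301.0663), §7, Steps 3 and 4.
-/

-- `Summit.Schanuel.Schanuel.…` is the mandated layout of this single-problem summit (CONVENTIONS §1).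
set_option linter.dupNamespace false

noncomputable section

namespace Summit.Schanuel.Schanuel.Theorems.RoyLinks

open Filter MvPolynomial Finset Height
open Literature.NumberTheory.Transcendental
open Literature.NumberTheory.Transcendental.Roy2013

/-- **Roy 2013, §7, Steps 3–4, exposed** (see the module docstring): the level `D*`, the bounds
`#O ≤ 8 (D*)^{2−τ}`, `h(O) ≤ A₃ (D*)^{1+β−τ}` (`A₃ = 74·2^{1+β−τ}`), and Step 4 on every
`𝒮 ⊆ O ∩ 𝒰` at depth `T* = T_{D*}`. Verbatim the Step-3/4 blocks of the tree's
`roy2013_thm_1_1_holds`, with `step4_orbit` in place of `step45_combined`.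
[cite: Roy2013, §7, Steps 3 and 4] -/
theorem level_step34 {ξ η : ℂ} {β τ ν : ℝ} (hτ0 : 0 < τ) (hτ2 : τ < 2) (hτβ : τ < β)
    {A₃ : ℝ} (hA₃ : A₃ = 74 * (2 : ℝ) ^ (1 + β - τ))
    {D₁ D : ℕ} {Tn : ℕ → ℕ} (hTge : ∀ n, n ≤ Tn n) (hT1 : ∀ n, D₁ ≤ n → 1 ≤ Tn n)
    (hT2 : ∀ n, D₁ ≤ n → (n : ℝ) ^ τ ≤ 2 * Tn n) (h5le : ∀ n, D₁ ≤ n → 5 ≤ n)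
    {Pt : ℕ → MvPolynomial (Fin 3) ℤ}
    (hPth : ∀ n, D₁ ≤ n → (map (Int.castRingHom ℂ) (Pt n)).IsHomogeneous n)
    (hPtZ : ∀ n, D₁ ≤ n → (Pt n).IsHomogeneous n)
    (hbodyPt : ∀ n, D₁ ≤ n → ∀ j ≤ 2 * Tn n,
      map (Int.castRingHom ℂ) ((homDK ℤ)^[j] (Pt n)) ∈
        royBody n ξ η (3 * (n : ℝ) ^ β) ((n : ℝ) ^ ν / 4) (Tn n))
    (Lf : ∀ n, D₁ ≤ n → LevelPkg n (Pt n))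
    (K : IntermediateField ℚ ℂ) [Normal ℚ K] [NumberField K]
    (hKn : ∀ n (hn : D₁ ≤ n), n ≤ D → ∀ i kk, (Lf n hn).α i kk ∈ K)
    (hPmem : ∀ n, D₁ ≤ n → map (Int.castRingHom ℂ) (Pt n) ∈
      royBody n ξ η (3 * (n : ℝ) ^ β) ((n : ℝ) ^ ν / 4) (Tn n))
    (hQmem : ∀ n (hn : D₁ ≤ n), map (Int.castRingHom ℂ) (levelQ n (Pt n) (Lf n hn).t) ∈
      royBody n ξ η (3 * (n : ℝ) ^ β) ((n : ℝ) ^ ν / 4) (Tn n))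
    (hchoose : ∀ n, D₁ ≤ n → Tn n ≤ (n + 1).choose 2)
    (hNlogN : ∀ n, D₁ ≤ n →
      ((3 * n + 2).choose 2 : ℝ) * Real.log ((3 * n + 2).choose 2 : ℝ) ≤ 7 * (n : ℝ) ^ (2 + β))
    (hbig4 : ∀ n, D₁ ≤ n → Real.log 2 + 2 * roy_c2 ξ η ^ 2 + (n : ℝ) * (A₃ * (n : ℝ) ^ (1 + β - τ)) +
        8 * (n : ℝ) ^ (2 - τ) * ((n : ℝ) * Real.log 3 + 3 * (n : ℝ) ^ β) < (n : ℝ) ^ ν / 4)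
    (hconst4 : ∀ n, D₁ ≤ n →
      2 * (n : ℝ) * Real.log 3 + Real.log 4 + (n : ℝ) * Real.log (roy_c4 ξ η) ≤ 2 * (n : ℝ) ^ β)
    (hD₁s : D₁ ≤ D₁ + 1) {ε₁ : ℝ}
    (hsep : ∀ α : Fin 3 → ℂ, ‖α‖ = 1 →
      eval α (toCX (map (Int.castRingHom ℚ) (Pt (D₁ + 1)))) = 0 →
      eval α (toCX (map (Int.castRingHom ℚ) (levelQ (D₁ + 1) (Pt (D₁ + 1)) (Lf _ hD₁s).t))) = 0 →
        ε₁ ≤ pdist ξ η α)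
    (hDD₁ : D₁ + 2 ≤ D)
    {PtL : MvPolynomial (Fin 3) ℤ} (L : LevelPkg D PtL) (hK : ∀ i kk, L.α i kk ∈ K)
    (hd₁pos : ∀ j, 0 < pdist ξ η (supNormalise (L.α j))) (j₀ : Fin L.m)
    (hvanO : ∀ R : MvPolynomial (Fin 3) ℤ, R.IsHomogeneous D →
      map (Int.castRingHom ℂ) R ∈ royBody D ξ η (3 * (D : ℝ) ^ β) ((D : ℝ) ^ ν / 4) (Tn D) →
        ∀ j ∈ (L.cfg K hK).orb j₀, aeval (L.α j) (map (Int.castRingHom ℂ) R) = 0)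
    (hchart : ∀ j ∈ (L.cfg K hK).orb j₀, L.α j 0 ≠ 0 ∧ L.α j 2 ≠ 0)
    {j₁ : Fin L.m} (hj₁O : j₁ ∈ (L.cfg K hK).orb j₀)
    (hsmallε : pdist ξ η (supNormalise (L.α j₁)) < ε₁) :
    ∃ Ds : ℕ, 1 ≤ Ds ∧ Ds + 1 ≤ D ∧
      (((L.cfg K hK).orb j₀).card : ℝ) ≤ 8 * (Ds : ℝ) ^ (2 - τ) ∧
      (∑ j ∈ (L.cfg K hK).orb j₀, logHeight ((L.cfg K hK).rep j)) / Module.finrank ℚ K ≤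
        A₃ * (Ds : ℝ) ^ (1 + β - τ) ∧
      ∀ S ⊆ ((L.cfg K hK).orb j₀).filter
          (fun j => pdist ξ η (supNormalise (L.α j)) ≤ (2 * roy_c2 ξ η)⁻¹),
        -(8 * ((Ds : ℝ) ^ β * ((L.cfg K hK).orb j₀).card) +
            Ds * ((∑ j ∈ (L.cfg K hK).orb j₀, logHeight ((L.cfg K hK).rep j)) /
              Module.finrank ℚ K)) ≤
          ∑ j ∈ S, max (Tn Ds * Real.log (pdist ξ η (supNormalise (L.α j))))
            (if 0 < adist ξ η (supNormalise (L.α j)) then Real.log (adist ξ η (supNormalise (L.α j)))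
              else Tn Ds * Real.log (pdist ξ η (supNormalise (L.α j)))) := by
  classical
  have h1le : ∀ n, D₁ ≤ n → 1 ≤ n := fun n hn => le_trans (by norm_num) (h5le n hn)
  have hD₁D : D₁ ≤ D := by omega
  have hc4 : 0 < roy_c4 ξ η := roy_c4_pos ξ η
  obtain ⟨O, hOdef⟩ : ∃ O : Finset (Fin L.m), O = (L.cfg K hK).orb j₀ := ⟨_, rfl⟩
  obtain ⟨hO, hhO⟩ : ∃ hO : ℝ, hO = (∑ j ∈ O, logHeight ((L.cfg K hK).rep j)) /
      Module.finrank ℚ K := ⟨_, rfl⟩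
  have hn0 : (0 : ℝ) < Module.finrank ℚ K := by exact_mod_cast Module.finrank_pos
  have hhO0 : 0 ≤ hO := by
    rw [hhO]; exact div_nonneg (sum_nonneg fun j _ => logHeight_nonneg _) hn0.le
  obtain ⟨d, hd⟩ : ∃ d : ℝ, d = O.card := ⟨_, rfl⟩
  have hOne : O.Nonempty := by rw [hOdef]; exact ⟨j₀, (L.cfg K hK).self_mem_orb j₀⟩
  have hd1 : 1 ≤ d := by rw [hd]; exact_mod_cast hOne.card_pos
  rw [← hOdef] at hj₁O hchart
  -- `𝒟ⁱP̃_n ∈ ℤ[X]_n`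
  have hPtih : ∀ n, D₁ ≤ n → ∀ i, ((homDK ℤ)^[i] (Pt n)).IsHomogeneous n := by
    intro n hn i
    induction i with
    | zero => exact hPtZ n hn
    | succ i ih => rw [Function.iterate_succ_apply']; exact isHomogeneous_homDK ih
  /- ───── Step 3: the level `D*` ───── -/
  -- containment predicate
  have hCex : ∃ n : ℕ, D₁ ≤ n ∧ n + 1 ≤ D ∧ ∀ (_ : D₁ ≤ n + 1), ∀ j ∈ O, ∀ i < 2 * Tn (n + 1),
      eval (L.α j) (homD^[i] (map (Int.castRingHom ℂ) (Pt (n + 1)))) = 0 := by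
    refine ⟨D - 1, by omega, by omega, fun _ j hj i hi => ?_⟩
    have hD1 : D - 1 + 1 = D := by omega
    rw [hD1] at hi ⊢
    have h := hvanO ((homDK ℤ)^[i] (Pt D)) (hPtih D hD₁D i) (hbodyPt D hD₁D i hi.le) j
      (by rw [← hOdef]; exact hj)
    rw [map_iterate_homDK] at h
    exact h
  obtain ⟨Ds, hDs⟩ : ∃ Ds : ℕ, Ds = Nat.find hCex := ⟨_, rfl⟩
  obtain ⟨hDs₁, hDsD, hCDs⟩ : D₁ ≤ Ds ∧ Ds + 1 ≤ D ∧ ∀ (_ : D₁ ≤ Ds + 1), ∀ j ∈ O,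
      ∀ i < 2 * Tn (Ds + 1), eval (L.α j) (homD^[i] (map (Int.castRingHom ℂ) (Pt (Ds + 1)))) = 0 := by
    rw [hDs]; exact Nat.find_spec hCex
  -- `D* > D₁` (separation at the level `D₁ + 1`)
  have hDsgt : D₁ < Ds := by
    by_contra hle
    have heq : Ds = D₁ := le_antisymm (not_lt.mp hle) hDs₁
    have hvan := hCDs (by omega)
    rw [heq] at hvan
    have hT2' : 2 ≤ 2 * Tn (D₁ + 1) := by have := hT1 (D₁ + 1) hD₁s; omega
    have hPz : eval (L.α j₁) (map (Int.castRingHom ℂ) (Pt (D₁ + 1))) = 0 := by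
      have := hvan j₁ hj₁O 0 (by omega); simpa using this
    have hQz : eval (L.α j₁) (map (Int.castRingHom ℂ)
        (levelQ (D₁ + 1) (Pt (D₁ + 1)) (Lf _ hD₁s).t)) = 0 := by
      rw [map_levelQ, map_sum]
      refine Finset.sum_eq_zero fun i hi => ?_
      have hi' : i < 2 * Tn (D₁ + 1) := by
        have := (mem_Icc.mp hi).2; have := hTge (D₁ + 1); omega
      rw [smul_eq_C_mul, map_mul, show (eval (L.α j₁)) (homD^[i] (map (Int.castRingHom ℂ)
        (Pt (D₁ + 1)))) = 0 from hvan j₁ hj₁O i hi', mul_zero]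
    have hscale : ∀ (F : CX) (m : ℕ), F.IsHomogeneous m → eval (L.α j₁) F = 0 →
        eval (supNormalise (L.α j₁)) F = 0 := by
      intro F m hF hz
      rw [show (eval (supNormalise (L.α j₁)) F : ℂ) = aeval (supNormalise (L.α j₁)) F from rfl,
        supNormalise, Roy2013.aeval_smul_of_isHomogeneous hF,
        show (aeval (L.α j₁) F : ℂ) = eval (L.α j₁) F from rfl, hz, mul_zero]
    have h := hsep _ (norm_supNormalise (L.α_ne_zero j₁))
      (by rw [toCX_map_int]; exact hscale _ _ (hPth _ hD₁s) hPz)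
      (by rw [toCX_map_int]; exact hscale _ _ (isHomogeneous_map_levelQ (hPth _ hD₁s) _) hQz)
    linarith only [h, hsmallε]
  -- non-containment at the level `D*`
  have hDs1 : 1 ≤ Ds := by have := h1le Ds hDs₁; omega
  have hnc : ∃ j ∈ O, ∃ i < 2 * Tn Ds, eval (L.α j) (homD^[i] (map (Int.castRingHom ℂ) (Pt Ds))) ≠ 0 := by
    have hmin : ¬(D₁ ≤ Ds - 1 ∧ Ds - 1 + 1 ≤ D ∧ ∀ (_ : D₁ ≤ Ds - 1 + 1), ∀ j ∈ O,
        ∀ i < 2 * Tn (Ds - 1 + 1),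
          eval (L.α j) (homD^[i] (map (Int.castRingHom ℂ) (Pt (Ds - 1 + 1)))) = 0) := by
      rw [hDs]; exact Nat.find_min hCex (by rw [← hDs]; omega)
    have hDs' : Ds - 1 + 1 = Ds := by omega
    rw [hDs'] at hmin
    push Not at hmin
    obtain ⟨-, j, hj, i, hi, hne⟩ := hmin (by omega) (by omega)
    exact ⟨j, hj, i, hi, hne⟩
  obtain ⟨jn, hjn, i₀, hi₀, hne⟩ := hnc
  -- the form `R = 𝒟^{i₀}P̃_{D*}`
  obtain ⟨R, hRdef⟩ : ∃ R : MvPolynomial (Fin 3) ℤ, R = (homDK ℤ)^[i₀] (Pt Ds) := ⟨_, rfl⟩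
  have hRh : R.IsHomogeneous Ds := by rw [hRdef]; exact hPtih Ds hDs₁ i₀
  have hRmem : map (Int.castRingHom ℂ) R ∈
      royBody Ds ξ η (3 * (Ds : ℝ) ^ β) ((Ds : ℝ) ^ ν / 4) (Tn Ds) := by
    rw [hRdef]; exact hbodyPt Ds hDs₁ i₀ hi₀.le
  have hRmap : map (Int.castRingHom ℂ) R = homD^[i₀] (map (Int.castRingHom ℂ) (Pt Ds)) := by
    rw [hRdef, map_iterate_homDK]
  have hRne : ∃ j ∈ (L.cfg K hK).orb j₀, aeval ((L.cfg K hK).α j) (map (Int.castRingHom ℂ) R) ≠ 0 := by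
    refine ⟨jn, by rw [← hOdef]; exact hjn, ?_⟩
    rw [hRmap]; exact hne
  -- Step 3 bounds at the level `D' = D* + 1`
  obtain ⟨D', hD'⟩ : ∃ D' : ℕ, D' = Ds + 1 := ⟨_, rfl⟩
  have hD'₁ : D₁ ≤ D' := by omega
  have hD'D : D' ≤ D := by omega
  obtain ⟨L', hL'def⟩ : ∃ L' : LevelPkg D' (Pt D'), L' = Lf D' hD'₁ := ⟨_, rfl⟩
  have hK' : ∀ i kk, L'.α i kk ∈ K := by rw [hL'def]; exact hKn D' hD'₁ hD'D
  obtain ⟨Li', hLi'1, hLi'2⟩ := exists_choose_window (hT1 D' hD'₁)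
  have hLD' : Li' < D' := window_lt hLi'1 (hchoose D' hD'₁)
  have hvan' : ∀ j ∈ (L.cfg K hK).orb j₀, ∀ kk < Tn D' + D',
      eval ((L.cfg K hK).α j) (homD^[kk] (map (Int.castRingHom ℂ) (Pt D'))) = 0 := by
    intro j hj kk hkk
    rw [hD'] at hkk ⊢
    exact hCDs (by omega) j (by rw [hOdef]; exact hj) kk (by have := hTge (Ds + 1); omega)
  obtain ⟨hdeg3, hht3⟩ := (L.cfg K hK).step3_bounds j₀ L' (hPth D' hD'₁) hK' hLi'1 hLi'2 hLD'
    (fun j hj => (hchart j (by rw [hOdef]; exact hj)).1)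
    (fun j hj => (hchart j (by rw [hOdef]; exact hj)).2) hvan'
  rw [← hOdef] at hdeg3 hht3
  -- `hO ≤ A₃ Ds^{1+β−τ}` and `d ≤ 8 Ds^{2−τ}`
  have hxs : (0 : ℝ) < Ds := by exact_mod_cast hDs1
  have hxs1 : (1 : ℝ) ≤ Ds := by exact_mod_cast hDs1
  have hx' : (0 : ℝ) < D' := by rw [hD']; push_cast; linarith only [hxs]
  have hD'2 : (D' : ℝ) ≤ 2 * Ds := by rw [hD']; push_cast; linarith only [hxs1]
  have hT'ge : (D' : ℝ) ^ τ ≤ 2 * Tn D' := hT2 D' hD'₁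
  have hlogL' : Real.log (∑ m ∈ L'.intF.support, |((coeff m L'.intF : ℤ) : ℝ)|) ≤
      37 * (D' : ℝ) ^ (2 + β) := by
    have hPm := hPmem D' hD'₁
    have hQm := hQmem D' hD'₁
    rw [← hL'def] at hQm
    have hY' : (0 : ℝ) < 3 * (D' : ℝ) ^ β := mul_pos (by norm_num) (Real.rpow_pos_of_pos hx' _)
    have h1 := L'.log_length_intF_le (MP := Real.exp (3 * (D' : ℝ) ^ β))
      (MQ := Real.exp (3 * (D' : ℝ) ^ β)) (Real.one_le_exp hY'.le) (Real.one_le_exp hY'.le)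
      hPm.2.1 hQm.2.1
    obtain ⟨N', hN'⟩ : ∃ N' : ℕ, N' = Fintype.card (PhiRow D') := ⟨_, rfl⟩
    obtain ⟨N₀', hN₀'⟩ : ∃ N₀' : ℕ,
        N₀' = Fintype.card ↥(finsuppAntidiag (univ : Finset (Fin 3)) (2 * D')) := ⟨_, rfl⟩
    obtain ⟨N₁', hN₁'⟩ : ∃ N₁' : ℕ, N₁' = Fintype.card ↥L'.M₁ := ⟨_, rfl⟩
    rw [← hN', ← hN₀', ← hN₁', Real.log_exp] at h1
    have hNeq' : (N' : ℝ) = ((3 * D' + 2).choose 2 : ℝ) := by rw [hN', LevelPkg.card_phiRow]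
    have h5' : 2 ≤ D' := le_trans (by norm_num) (h5le D' hD'₁)
    have hN₀r' : (N₀' : ℝ) ≤ 5 * (D' : ℝ) ^ 2 := by
      rw [hN₀', LevelPkg.card_antidiag_two]; exact choose_two_le h5'
    have hN₁r' : (N₁' : ℝ) ≤ 5 * (D' : ℝ) ^ 2 := by
      have : N₁' ≤ (2 * D' + 2).choose 2 := by rw [hN₁']; exact L'.card_M₁_le
      exact le_trans (by exact_mod_cast this) (choose_two_le h5')
    have hf := LevelPkg.log_factorial_le N'
    have hNN := hNlogN D' hD'₁
    have hp2b' : (D' : ℝ) ^ (2 + β) = (D' : ℝ) ^ 2 * (D' : ℝ) ^ β := by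
      rw [Real.rpow_add hx', Real.rpow_two]
    rw [hp2b', ← hNeq'] at hNN
    rw [hp2b']
    have hβ' : 0 ≤ (D' : ℝ) ^ β := Real.rpow_nonneg hx'.le _
    have h3β : (0 : ℝ) ≤ 3 * (D' : ℝ) ^ β := mul_nonneg (by norm_num) hβ'
    have e1 := mul_le_mul_of_nonneg_right hN₀r' h3β
    have e2 := mul_le_mul_of_nonneg_right hN₁r' h3β
    linarith only [h1, hf, hNN, e1, e2]
  have hhOle : hO ≤ A₃ * (Ds : ℝ) ^ (1 + β - τ) := by
    have h1 : (Tn D' : ℝ) * (D' * (hO * Module.finrank ℚ K)) ≤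
        Module.finrank ℚ K * (37 * (D' : ℝ) ^ (2 + β)) := by
      have : hO * Module.finrank ℚ K = ∑ j ∈ O, logHeight ((L.cfg K hK).rep j) := by
        rw [hhO]; field_simp
      rw [this]
      exact hht3.trans (mul_le_mul_of_nonneg_left hlogL' hn0.le)
    have h2 : (Tn D' : ℝ) * D' * hO ≤ 37 * (D' : ℝ) ^ (2 + β) := by
      have h1' : ((Tn D' : ℝ) * D' * hO) * Module.finrank ℚ K ≤
          (37 * (D' : ℝ) ^ (2 + β)) * Module.finrank ℚ K := by linarith only [h1]
      exact le_of_mul_le_mul_right h1' hn0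
    have h3 : hO * ((D' : ℝ) ^ τ * D') ≤ 74 * (D' : ℝ) ^ (2 + β) := by
      have e := mul_le_mul_of_nonneg_left hT'ge (mul_nonneg hhO0 hx'.le)
      linarith only [e, h2]
    have h4 : (D' : ℝ) ^ (2 + β) = (D' : ℝ) ^ (1 + β - τ) * ((D' : ℝ) ^ τ * D') := by
      have e : (2 : ℝ) + β = (1 + β - τ) + τ + 1 := by ring
      rw [e, Real.rpow_add hx', Real.rpow_add hx', Real.rpow_one]; ring
    rw [h4] at h3
    have hpos : 0 < (D' : ℝ) ^ τ * D' := mul_pos (Real.rpow_pos_of_pos hx' _) hx'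
    have h5 : hO ≤ 74 * (D' : ℝ) ^ (1 + β - τ) :=
      le_of_mul_le_mul_right (by linarith only [h3]) hpos
    have h6 : (D' : ℝ) ^ (1 + β - τ) ≤ (2 * Ds : ℝ) ^ (1 + β - τ) :=
      Real.rpow_le_rpow hx'.le hD'2 (by linarith only [hτβ])
    rw [Real.mul_rpow (by norm_num) hxs.le] at h6
    have e := mul_le_mul_of_nonneg_left h6 (by norm_num : (0 : ℝ) ≤ 74)
    rw [hA₃]; linarith only [h5, e]
  have hdle : d ≤ 8 * (Ds : ℝ) ^ (2 - τ) := by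
    have h1 : (Tn D' : ℝ) * d ≤ (D' : ℝ) ^ 2 := by rw [hd]; exact_mod_cast hdeg3
    have h2 : d * ((D' : ℝ) ^ τ) ≤ 2 * (D' : ℝ) ^ 2 := by
      have e := mul_le_mul_of_nonneg_left hT'ge (by linarith only [hd1] : (0 : ℝ) ≤ d)
      linarith only [e, h1]
    have h3 : (D' : ℝ) ^ (2 : ℕ) = (D' : ℝ) ^ (2 - τ) * (D' : ℝ) ^ τ := by
      rw [← Real.rpow_add hx', ← Real.rpow_two]; congr 1; ring
    rw [h3] at h2
    have hpos : 0 < (D' : ℝ) ^ τ := Real.rpow_pos_of_pos hx' _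
    have h4 : d ≤ 2 * (D' : ℝ) ^ (2 - τ) := le_of_mul_le_mul_right (by linarith only [h2]) hpos
    have h5 : (D' : ℝ) ^ (2 - τ) ≤ (2 * Ds : ℝ) ^ (2 - τ) :=
      Real.rpow_le_rpow hx'.le hD'2 (by linarith only [hτ2])
    rw [Real.mul_rpow (by norm_num) hxs.le] at h5
    have h6 : (2 : ℝ) ^ (2 - τ) ≤ 4 := by
      calc (2 : ℝ) ^ (2 - τ) ≤ (2 : ℝ) ^ (2 : ℝ) :=
            Real.rpow_le_rpow_of_exponent_le (by norm_num) (by linarith only [hτ0])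
        _ = 4 := by norm_num
    have e := mul_le_mul_of_nonneg_right h6 (Real.rpow_nonneg hxs.le (2 - τ))
    linarith only [h4, h5, e]
  /- ───── Step 4 at the level `D*` ───── -/
  have hYs : 0 ≤ (Ds : ℝ) * Real.log 3 + 3 * (Ds : ℝ) ^ β :=
    add_nonneg (mul_nonneg hxs.le (Real.log_nonneg (by norm_num)))
      (mul_nonneg (by norm_num) (Real.rpow_nonneg hxs.le _))
  have hbig : Real.log 2 + 2 * roy_c2 ξ η ^ 2 - (Ds : ℝ) ^ ν / 4 <
      -(Ds * ((∑ j ∈ (L.cfg K hK).orb j₀, logHeight ((L.cfg K hK).rep j)) /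
          Module.finrank ℚ K) +
        ((L.cfg K hK).orb j₀).card * (Ds * Real.log 3 + 3 * (Ds : ℝ) ^ β)) := by
    rw [← hOdef, ← hhO, ← hd]
    have h4 := hbig4 Ds hDs₁
    have h1 : (Ds : ℝ) * hO ≤ (Ds : ℝ) * (A₃ * (Ds : ℝ) ^ (1 + β - τ)) :=
      mul_le_mul_of_nonneg_left hhOle hxs.le
    have h2 : d * ((Ds : ℝ) * Real.log 3 + 3 * (Ds : ℝ) ^ β) ≤
        8 * (Ds : ℝ) ^ (2 - τ) * ((Ds : ℝ) * Real.log 3 + 3 * (Ds : ℝ) ^ β) :=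
      mul_le_mul_of_nonneg_right hdle hYs
    linarith only [h4, h1, h2]
  -- the Step-4 constant: `Ds hO + d (Ds log 3 + 3Ds^β) + d log(4·3^Ds e^{3Ds^β} c₄^Ds) ≤ 8 Ds^β d + Ds hO`
  have hlog4 : 0 ≤ Real.log (4 * (3 ^ Ds * Real.exp (3 * (Ds : ℝ) ^ β) * roy_c4 ξ η ^ Ds)) := by
    refine Real.log_nonneg ?_
    have hY1 : Real.exp (-(Ds * Real.log 3)) ≤ Real.exp (3 * (Ds : ℝ) ^ β) :=
      Real.exp_le_exp.mpr (by linarith only [hYs])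
    have h3 : Real.exp (-(Ds * Real.log 3)) * 3 ^ Ds = 1 := by
      rw [← Real.rpow_natCast, ← Real.exp_log (by norm_num : (0 : ℝ) < 3), ← Real.exp_mul,
        Real.log_exp, ← Real.exp_add]; simp [mul_comm]
    have hc4D : (1 : ℝ) ≤ roy_c4 ξ η ^ Ds := one_le_pow₀ (by
      have := one_le_roy_c2 ξ η
      rw [roy_c4, roy_A]
      nlinarith [Real.add_one_le_exp (2 * roy_c2 ξ η ^ 2), Real.exp_pos (roy_c2 ξ η)])
    have h1 : (1 : ℝ) ≤ 3 ^ Ds * Real.exp (3 * (Ds : ℝ) ^ β) * roy_c4 ξ η ^ Ds :=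
      calc (1 : ℝ) = Real.exp (-(Ds * Real.log 3)) * 3 ^ Ds * 1 := by rw [h3, one_mul]
        _ ≤ Real.exp (3 * (Ds : ℝ) ^ β) * 3 ^ Ds * roy_c4 ξ η ^ Ds := by gcongr
        _ = 3 ^ Ds * Real.exp (3 * (Ds : ℝ) ^ β) * roy_c4 ξ η ^ Ds := by ring
    linarith only [h1]
  have hR8 : (Ds : ℝ) * hO + d * (Ds * Real.log 3 + 3 * (Ds : ℝ) ^ β) +
      d * Real.log (4 * (3 ^ Ds * Real.exp (3 * (Ds : ℝ) ^ β) * roy_c4 ξ η ^ Ds)) ≤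
        8 * (Ds : ℝ) ^ β * d + Ds * hO := by
    have hlog : Real.log (4 * (3 ^ Ds * Real.exp (3 * (Ds : ℝ) ^ β) * roy_c4 ξ η ^ Ds)) =
        Real.log 4 + Ds * Real.log 3 + 3 * (Ds : ℝ) ^ β + Ds * Real.log (roy_c4 ξ η) := by
      have p3 : (0 : ℝ) < 3 ^ Ds := pow_pos (by norm_num) _
      have pe : (0 : ℝ) < Real.exp (3 * (Ds : ℝ) ^ β) := Real.exp_pos _
      have pc : (0 : ℝ) < roy_c4 ξ η ^ Ds := pow_pos hc4 _
      rw [Real.log_mul (by norm_num) (mul_pos (mul_pos p3 pe) pc).ne',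
        Real.log_mul (mul_pos p3 pe).ne' pc.ne', Real.log_mul p3.ne' pe.ne', Real.log_pow,
        Real.log_exp, Real.log_pow]; ring
    rw [hlog]
    have e := mul_le_mul_of_nonneg_left (hconst4 Ds hDs₁) (by linarith only [hd1] : (0 : ℝ) ≤ d)
    linarith only [e]
  /- ───── assemble ───── -/
  refine ⟨Ds, hDs1, hDsD, by rw [← hOdef, ← hd]; exact hdle, by rw [← hOdef, ← hhO]; exact hhOle,
    fun S hS => ?_⟩
  rw [← hOdef] at hS
  have hSO' : S ⊆ O := hS.trans (filter_subset _ _)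
  have hSO : S ⊆ (L.cfg K hK).orb j₀ := by rw [← hOdef]; exact hSO'
  have hSU : ∀ j ∈ S, pdist ξ η (supNormalise ((L.cfg K hK).α j)) ≤ (2 * roy_c2 ξ η)⁻¹ :=
    fun j hj => (mem_filter.mp (hS hj)).2
  obtain ⟨b, hb⟩ : ∃ b : Fin L.m → ℝ, b = fun j =>
      if 0 < adist ξ η (supNormalise (L.α j)) then Real.log (adist ξ η (supNormalise (L.α j)))
      else Tn Ds * Real.log (pdist ξ η (supNormalise (L.α j))) := ⟨_, rfl⟩
  have hbj : ∀ j, b j = (if 0 < adist ξ η (supNormalise (L.α j)) then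
      Real.log (adist ξ η (supNormalise (L.α j)))
      else Tn Ds * Real.log (pdist ξ η (supNormalise (L.α j)))) := fun j => by rw [hb]
  have hstep := (L.cfg K hK).step4_orbit j₀ hRh hRmem hRne S hSO hSU (fun j _ => hd₁pos j) b
    (fun j _ hpos => by
      rw [hb]; simp only [LevelPkg.cfg_α] at hpos ⊢; simp only [hpos, if_true, le_refl]) hYs hbig
  rw [← hOdef, ← hhO, ← hd] at hstep ⊢
  have hcardS : (S.card : ℝ) ≤ d := by rw [hd]; exact_mod_cast card_le_card hSO'
  refine le_trans ?_ (hstep.trans (le_of_eq (Finset.sum_congr rfl fun j _ => by rw [hbj]; rfl)))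
  have e := mul_le_mul_of_nonneg_right hcardS hlog4
  linarith only [hR8, e, hlog4]

end Summit.Schanuel.Schanuel.Theorems.RoyLinks

end
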